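/-
Copyright (c) 2026. All rights reserved.
Released under Apache 2.0 license as described in the file LICENSE.
Origin: expansion seat `planner-pub-hodgecm-qw8-0` (unit pub-hodgecm-qw8), handover v3 2026-08-18T03:18:14Z (`HOME/pub-hodgecm-qw8/Qw8Complement.lean`, md5 58debb68);
landed by the gen-5 packager as `HodgeCM/StubTree/Qw8Complement.lean` (trailing `#print axioms` moved to the audit lists; body otherwise verbatim).
-/
import Summits.HodgeConjecture.HodgeCM.StubTree.Qw8

/-!
# [QW8] Thm 2.5 step (iii), character half: the top-degree weight has Lefschetz character `0`

Step (iii) of the proof of [QW8] Thm 2.5 (`t:suff`, tex ll. 255–258 of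
`inputs/2001/…y3__paper-v1-892bb948.tex` @ a463a4c8cc18) reads: "The intersection pairing
`H_k(Y') ⊗ H_{2 dim Y' − k}(Y') → ℚ` is `T`-invariant up to the character of `H_{2 dim Y'}`, WHOSE
`a`-INVARIANT IS `0`; hence it pairs the weight space of `w` perfectly with a weight space all of whose
vectors have `a = −a(w)` …".  The combinatorial assertion in it — the full weight `(j ↦ Hom(F,ℂ))` (the
weight of the top-degree class of `∏_j A_{(F,Θ_j)}`) has Lefschetz character `0`, hence complementary
weights have opposite characters — is PROVED here, for every CM field `F`:

* `lefChar_univ_eq_zero  : lefChar Θ (fun _ => Finset.univ) = 0`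
* `lefChar_add_lefChar_compl : lefChar Θ S + lefChar Θ (fun j => (S j)ᶜ) = 0`

(the embeddings of a CM field come in conjugate pairs `s ≠ s̄` — `F` is totally complex — with
`Θ^{(s̄)} = \overline{Θ^{(s)}}` (`pullType_conjugate`, StubTree/Qw8.lean) and `ā[Ψ] + ā[Ψ̄] = 0`
(`achar_add_achar_bar`)).  What remains OPEN of (iii)+(v) is purely geometric and is the named `Prop`
`HodgeCM.Universe.Qw8DualPushPull` (Poincaré duality of the weight decomposition and Gysin push–pull, absent
from the `Universe` signature); `qw8DualPushPull_iff_compl` records that its character clause may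
equivalently be read with the complementary weight.  Speedrun expansion seat `pub-hodgecm-qw8`, v3.
-/

noncomputable section

open scoped Classical

namespace HodgeCM

open NumberField NumberField.ComplexEmbedding
open Literature.AlgebraicGeometry.Motives (CMType)

section Char

variable {F : Type} [Field F] [NumberField F] [IsCMField F]

/-- **The top weight has character zero**: `Σ_j Σ_{all s} ā[Θ_j^{(s)}] = 0` ([QW8] Thm 2.5 (iii):
"the character of `H_{2 dim Y'}`, whose `a`-invariant is `0`"). -/
theorem lefChar_univ_eq_zero {n : ℕ} (Θ : Fin (n + 1) → CMType F) :
    lefChar Θ (fun _ => Finset.univ) = 0 := by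
  unfold lefChar
  refine Finset.sum_eq_zero fun j _ => ?_
  exact Finset.sum_involution (fun s _ => conjugate s)
    (fun s _ => by rw [pullType_conjugate, achar_add_achar_bar])
    (fun s _ _ h => IsTotallyComplex.complexEmbedding_not_isReal s (isReal_iff.mpr h))
    (fun s _ => Finset.mem_univ _)
    (fun s _ => involutive_conjugate F s)

/-- **Complementary weights have opposite Lefschetz characters**: `a(e_S) + a(e_{Sᶜ}) = 0`
(the character bookkeeping of the Poincaré-dual partner `w^∨` in [QW8] Thm 2.5 (iii)). -/
theorem lefChar_add_lefChar_compl {n : ℕ} (Θ : Fin (n + 1) → CMType F)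
    (S : Fin (n + 1) → Finset (F →+* ℂ)) :
    lefChar Θ S + lefChar Θ (fun j => (S j)ᶜ) = 0 := by
  rw [← lefChar_univ_eq_zero Θ]
  unfold lefChar
  rw [← Finset.sum_add_distrib]
  refine Finset.sum_congr rfl fun j _ => ?_
  exact Finset.sum_add_sum_compl (S j) (fun s => achar (pullType (Θ j) s))

end Char

namespace Universe

variable (U : Universe)

/-- `Qw8DualPushPull` with the character of `Z` written as `a(e) + a(e_{S_Wᶜ})` (the weight of the dual
partner) instead of `a(e) − a(W)`: equivalent, by `lefChar_add_lefChar_compl`. -/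
theorem qw8DualPushPull_iff_compl :
    U.Qw8DualPushPull ↔
      ∀ (F : CMField), IsGalois ℚ F → 6 ≤ Module.finrank ℚ F → ∀ (e W : U.WVec F), W.IsAlg →
        ∃ Z : U.WVec F, Z.achar = e.achar + lefChar W.Θ (fun j => (W.S j)ᶜ) ∧ (Z.IsAlg → e.IsAlg) := by
  have key : ∀ (F : CMField) (W : U.WVec F), lefChar W.Θ (fun j => (W.S j)ᶜ) = -W.achar := fun F W =>
    eq_neg_of_add_eq_zero_right (lefChar_add_lefChar_compl W.Θ W.S)
  simp only [key, ← sub_eq_add_neg]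
  rfl

end Universe

end HodgeCM

end
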